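import Summits.CriticalPhenomena.Ising3DConformalLimit.Theses.SubPtolemyInterlacing
import Summits.CriticalPhenomena.Ising3DConformalLimit.Theorems.SubPtolemyInterlacingInterlacingForcesU4
import HarnessLib

/-!
# Line `Sketch` for the crux `SubPtolemyInterlacing.Interlacing` (stmt-CriticalPhenomena-15702) — transfer lemma
# `transfer_ising3D_of_eventualBalanced`: the route consumes only the EVENTUAL BALANCED DYADIC form of the crux

THEOREM-ONLY helper file of the line `Sketch` (lead skeleton `Cruxes/Interlacing/Lines/Sketch.lean`). It records, as
Lean theorems, the lead's cycle-1 diagnosis of WHAT PART of the all-gaps crux `Interlacing` the route actually uses: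

* `transfer_hasNontrivialU4_of_eventualBalanced` — the conclusion of `InterlacingForcesU4` (clause (iii),
  `HasNontrivialU4 S`, for every non-degenerate translation-invariant scale-covariant pointwise limit) follows from
  `SubPtolemyFloor` and the sub-Ptolemy inequality at the BALANCED DYADIC quadruples `(0, 2N, 3N, 6N)·e₁`, `N = 2^{k+1}`,
  for all `k ≥ K` only (cross-ratio `z = ½` at every scale; no small gaps, no `(a, ka, a)` / `(n, b, n)` bands).
  Proof: the landed `interlacingForcesU4_proof` verbatim, with its limit step `interlacingForcesU4_limit_subPtolemy'`
  (which is already stated for the eventual dyadic hypothesis) fed directly.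
* `transfer_ising3D_of_eventualBalanced` (the registered stub) — hence the sub-problem `Ising3DConformalLimit` follows
  from (eventual balanced dyadic SPC) ∧ `SubPtolemyFloor` ∧ `MoebiusLimit`: the route's deciding theorem `closes` with its
  first hypothesis WEAKENED.
* `transfer_eventualBalanced_of_interlacing`, `transfer_eventualBalanced_of_balanced` — the weakened hypothesis is implied
  by `Interlacing` (take `K = 0`) and by the scale-indexed balanced form `∀ N ≥ N₀, SPC(2N, N, 3N)`.

Why this matters (lead's line card, cycle 1): in the bands `z → 0` (`(a, ka, a)`, `k → ∞`) and `z → 1` (`(n, b, n)`,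
`1 ≪ b ≪ n`) the all-gaps inequality is asymptotically TIGHT and its sign is the competition "energy exchange `b^{-2Δ_ε}`
vs two-point curvature `2Δ/b²`", i.e. it encodes `Δ_ε(3) > 1` with constants — an open problem foreign to the route's
mechanism; at `z = ½` the margin is ≥ 15 % at every scale (lattice MC and bootstrap). The planner may therefore `--restate`
the crux to the eventual balanced dyadic form without touching the assembly. No definitions, no named facts, no sorry.
-/

noncomputable section

namespace Summit.CriticalPhenomena.Ising3DConformalLimit.Cruxes.Interlacing.Sketch

open Filter Topology
open Literature.Probability.LatticeModels
open Summit.CriticalPhenomena.Ising3DConformalLimit.Theses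
open Summit.CriticalPhenomena.Ising3DConformalLimit.Theses.SubPtolemyInterlacing
open Summit.CriticalPhenomena.Ising3DConformalLimit.Theorems
open EuclideanSpace (single)

/-- **Clause (iii) from the eventual balanced dyadic sub-Ptolemy inequality.** If the critical correlators satisfy the
sub-Ptolemy inequality at the balanced dyadic axis quadruples `(0, 2N, 3N, 6N)·e₁`, `N = 2^{k+1}`, for all `k ≥ K`, and the
axial floor `SubPtolemyFloor` holds, then every pointwise scaling limit `S` of `criticalCorr 3` (renormalisation `ρ > 0` on
`(0,1]`) that is non-degenerate, translation invariant and scale covariant with dimension `Δ` has `U₄ ≢ 0` — in fact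
`U₄((0,2,3,6)·e₁) < 0`. The landed proof of `InterlacingForcesU4` verbatim, with the limit step
`interlacingForcesU4_limit_subPtolemy'` fed the eventual hypothesis. [cite: DuminilCopinICM2022, §8.1] -/
theorem transfer_hasNontrivialU4_of_eventualBalanced
    (hI : ∃ K : ℕ, ∀ k : ℕ, K ≤ k →
      criticalCorr 3 4 ![Pi.single 0 ((0 : ℕ) : ℤ), Pi.single 0 ((2 * 2 ^ (k + 1) : ℕ) : ℤ),
          Pi.single 0 ((3 * 2 ^ (k + 1) : ℕ) : ℤ), Pi.single 0 ((6 * 2 ^ (k + 1) : ℕ) : ℤ)] *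
          (criticalCorr 3 2 ![Pi.single 0 ((0 : ℕ) : ℤ), Pi.single 0 ((3 * 2 ^ (k + 1) : ℕ) : ℤ)] *
            criticalCorr 3 2 ![Pi.single 0 ((2 * 2 ^ (k + 1) : ℕ) : ℤ),
              Pi.single 0 ((6 * 2 ^ (k + 1) : ℕ) : ℤ)]) ≤
        criticalCorr 3 2 ![Pi.single 0 ((0 : ℕ) : ℤ), Pi.single 0 ((2 * 2 ^ (k + 1) : ℕ) : ℤ)] *
            criticalCorr 3 2 ![Pi.single 0 ((3 * 2 ^ (k + 1) : ℕ) : ℤ),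
              Pi.single 0 ((6 * 2 ^ (k + 1) : ℕ) : ℤ)] *
          (criticalCorr 3 2 ![Pi.single 0 ((0 : ℕ) : ℤ), Pi.single 0 ((6 * 2 ^ (k + 1) : ℕ) : ℤ)] *
            criticalCorr 3 2 ![Pi.single 0 ((2 * 2 ^ (k + 1) : ℕ) : ℤ),
              Pi.single 0 ((3 * 2 ^ (k + 1) : ℕ) : ℤ)]))
    (hF : SubPtolemyFloor) :
    ∀ (ρ : ℝ → ℝ) (Δ : ℝ) (S : CorrFamily 3), (∀ δ ∈ Set.Ioc (0:ℝ) 1, 0 < ρ δ) →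
      HasPointwiseScalingLimit (criticalCorr 3) ρ S → IsNondegenerateTwoPoint S →
      IsTranslationInvariant S → IsScaleCovariant Δ S → HasNontrivialU4 S := by
  intro ρ Δ S hρ hlim hnd htr hsc
  obtain ⟨K, hK⟩ := hI
  obtain ⟨a, c, ha, hc, hfloor⟩ := hF
  -- the doubling ratio `u = 2^{-2Δ}` and its lower bound from the floor
  set u : ℝ := (2:ℝ) ^ (-(2:ℝ) * Δ) with hu
  have hu0 : 0 < u := Real.rpow_pos_of_pos (by norm_num) _
  have hΔa : 2 * Δ ≤ a := interlacingForcesU4_two_mul_dim_le_of_axialFloor hc hfloor hρ hlim hnd hsc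
  have huroot : Real.sqrt 2 - 1 < u := interlacingForcesU4_sqrt_two_sub_one_lt_doublingRatio ha hΔa
  -- the two positive numbers `s₁ = S₂(0,e₁)`, `s₃ = S₂(0,3e₁)`
  have hs1 : 0 < S 2 ![0, single 0 1] := hnd _ (zero_unitVec_mem_nonCoincident one_ne_zero)
  have hs3 : 0 < S 2 ![0, single 0 3] := hnd _ (zero_unitVec_mem_nonCoincident (by norm_num))
  -- doubling (scale covariance at `c = 2`) and axis translations: the six pair values at `x⋆`
  have e01 : S 2 ![0, single 0 2] = u * S 2 ![0, single 0 1] := by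
    have h := interlacingForcesU4_S_two_axis_double hsc 1
    rw [mul_one] at h
    rw [hu]; exact h
  have hd2 : S 2 ![0, single 0 4] = u * S 2 ![0, single 0 2] := by
    have h := interlacingForcesU4_S_two_axis_double hsc 2
    rw [show (2:ℝ) * 2 = 4 by norm_num] at h
    rw [hu]; exact h
  have e03 : S 2 ![0, single 0 6] = u * S 2 ![0, single 0 3] := by
    have h := interlacingForcesU4_S_two_axis_double hsc 3
    rw [show (2:ℝ) * 3 = 6 by norm_num] at h
    rw [hu]; exact h
  have e13 : S 2 ![single 0 2, single 0 6] = u ^ 2 * S 2 ![0, single 0 1] := by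
    have h := interlacingForcesU4_S_two_axis_translate htr 2 6
    rw [show (6:ℝ) - 2 = 4 by norm_num] at h
    rw [h, hd2, e01]; ring
  have e23 : S 2 ![single 0 3, single 0 6] = S 2 ![0, single 0 3] := by
    have h := interlacingForcesU4_S_two_axis_translate htr 3 6
    rwa [show (6:ℝ) - 3 = 3 by norm_num] at h
  have e12 : S 2 ![single 0 2, single 0 3] = S 2 ![0, single 0 1] := by
    have h := interlacingForcesU4_S_two_axis_translate htr 2 3
    rwa [show (3:ℝ) - 2 = 1 by norm_num] at h
  -- the limit sub-Ptolemy inequality at `x⋆`, from the EVENTUAL dyadic hypothesis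
  have hspc : S 4 ![0, single 0 2, single 0 3, single 0 6] *
        (S 2 ![0, single 0 3] * S 2 ![single 0 2, single 0 6]) ≤
      S 2 ![0, single 0 2] * S 2 ![single 0 3, single 0 6] *
        (S 2 ![0, single 0 6] * S 2 ![single 0 2, single 0 3]) :=
    interlacingForcesU4_limit_subPtolemy' _ rfl K hK hlim
  rw [e01, e23, e13, e03, e12] at hspc
  -- conclude: `U₄(x⋆) < 0`
  refine ⟨![0, single 0 2, single 0 3, single 0 6], interlacingForcesU4_xStar_mem_nonCoincident,
    ne_of_lt ?_⟩
  show S 4 ![0, single 0 2, single 0 3, single 0 6] -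
      (S 2 ![0, single 0 2] * S 2 ![single 0 3, single 0 6] +
        S 2 ![0, single 0 3] * S 2 ![single 0 2, single 0 6] +
        S 2 ![0, single 0 6] * S 2 ![single 0 2, single 0 3]) < 0
  rw [e01, e23, e13, e03, e12]
  exact interlacingForcesU4_u4_balanced_neg hs1 hs3 hu0 huroot hspc

/-- **Transfer (registered stub `transfer_ising3D_of_eventualBalanced`): the sub-problem from the WEAKENED crux.**
`Ising3DConformalLimit` follows from the eventual balanced dyadic sub-Ptolemy inequality (SPC at `(0,2N,3N,6N)·e₁`,
`N = 2^{k+1}`, all `k ≥ K`), `SubPtolemyFloor` and `MoebiusLimit` — the route's deciding theorem `closes` with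
`Interlacing` replaced by the only instances its assembly consumes. [cite: DuminilCopinICM2022, §8.1] -/
theorem transfer_ising3D_of_eventualBalanced :
    (∃ K : ℕ, ∀ k : ℕ, K ≤ k →
      criticalCorr 3 4 ![Pi.single 0 ((0 : ℕ) : ℤ), Pi.single 0 ((2 * 2 ^ (k + 1) : ℕ) : ℤ),
          Pi.single 0 ((3 * 2 ^ (k + 1) : ℕ) : ℤ), Pi.single 0 ((6 * 2 ^ (k + 1) : ℕ) : ℤ)] *
          (criticalCorr 3 2 ![Pi.single 0 ((0 : ℕ) : ℤ), Pi.single 0 ((3 * 2 ^ (k + 1) : ℕ) : ℤ)] *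
            criticalCorr 3 2 ![Pi.single 0 ((2 * 2 ^ (k + 1) : ℕ) : ℤ),
              Pi.single 0 ((6 * 2 ^ (k + 1) : ℕ) : ℤ)]) ≤
        criticalCorr 3 2 ![Pi.single 0 ((0 : ℕ) : ℤ), Pi.single 0 ((2 * 2 ^ (k + 1) : ℕ) : ℤ)] *
            criticalCorr 3 2 ![Pi.single 0 ((3 * 2 ^ (k + 1) : ℕ) : ℤ),
              Pi.single 0 ((6 * 2 ^ (k + 1) : ℕ) : ℤ)] *
          (criticalCorr 3 2 ![Pi.single 0 ((0 : ℕ) : ℤ), Pi.single 0 ((6 * 2 ^ (k + 1) : ℕ) : ℤ)] *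
            criticalCorr 3 2 ![Pi.single 0 ((2 * 2 ^ (k + 1) : ℕ) : ℤ),
              Pi.single 0 ((3 * 2 ^ (k + 1) : ℕ) : ℤ)])) →
    SubPtolemyFloor → MoebiusLimit → _root_.Ising3DConformalLimit := by
  intro hI hF hML
  obtain ⟨ρ, Δ, S, hρ, hΔ, hlim, hnd, hmob⟩ := hML
  exact ⟨ρ, Δ, S, hρ, hΔ, hlim, hnd, hmob,
    transfer_hasNontrivialU4_of_eventualBalanced hI hF ρ Δ S hρ hlim hnd hmob.1.1 hmob.2.1⟩

/-- `Interlacing` (all gaps) implies the eventual balanced dyadic form (`K = 0`, `N = 2^{k+1} ≥ 1`): the restated crux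
is WEAKER than the filed one. [folklore] -/
theorem transfer_eventualBalanced_of_interlacing (hI : Interlacing) :
    ∃ K : ℕ, ∀ k : ℕ, K ≤ k →
      criticalCorr 3 4 ![Pi.single 0 ((0 : ℕ) : ℤ), Pi.single 0 ((2 * 2 ^ (k + 1) : ℕ) : ℤ),
          Pi.single 0 ((3 * 2 ^ (k + 1) : ℕ) : ℤ), Pi.single 0 ((6 * 2 ^ (k + 1) : ℕ) : ℤ)] *
          (criticalCorr 3 2 ![Pi.single 0 ((0 : ℕ) : ℤ), Pi.single 0 ((3 * 2 ^ (k + 1) : ℕ) : ℤ)] *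
            criticalCorr 3 2 ![Pi.single 0 ((2 * 2 ^ (k + 1) : ℕ) : ℤ),
              Pi.single 0 ((6 * 2 ^ (k + 1) : ℕ) : ℤ)]) ≤
        criticalCorr 3 2 ![Pi.single 0 ((0 : ℕ) : ℤ), Pi.single 0 ((2 * 2 ^ (k + 1) : ℕ) : ℤ)] *
            criticalCorr 3 2 ![Pi.single 0 ((3 * 2 ^ (k + 1) : ℕ) : ℤ),
              Pi.single 0 ((6 * 2 ^ (k + 1) : ℕ) : ℤ)] *
          (criticalCorr 3 2 ![Pi.single 0 ((0 : ℕ) : ℤ), Pi.single 0 ((6 * 2 ^ (k + 1) : ℕ) : ℤ)] *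
            criticalCorr 3 2 ![Pi.single 0 ((2 * 2 ^ (k + 1) : ℕ) : ℤ),
              Pi.single 0 ((3 * 2 ^ (k + 1) : ℕ) : ℤ)]) :=
  ⟨0, fun k _ => interlacingForcesU4_interlacing_balanced hI (2 ^ (k + 1)) Nat.one_le_two_pow⟩

/-- The scale-indexed balanced form `∀ N ≥ N₀, SPC(2N, N, 3N)` (any `N₀`) implies the eventual balanced dyadic form
(take `K` with `2^{K+1} ≥ N₀`). This is the cleanest restatement candidate: one two-parameter-free family of shapes with
cross-ratio `z = ½` at every scale. [folklore] -/
theorem transfer_eventualBalanced_of_balanced (N₀ : ℕ)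
    (h : ∀ N : ℕ, N₀ ≤ N → 1 ≤ N →
      criticalCorr 3 4 ![Pi.single 0 ((0 : ℕ) : ℤ), Pi.single 0 ((2 * N : ℕ) : ℤ),
          Pi.single 0 ((3 * N : ℕ) : ℤ), Pi.single 0 ((6 * N : ℕ) : ℤ)] *
          (criticalCorr 3 2 ![Pi.single 0 ((0 : ℕ) : ℤ), Pi.single 0 ((3 * N : ℕ) : ℤ)] *
            criticalCorr 3 2 ![Pi.single 0 ((2 * N : ℕ) : ℤ), Pi.single 0 ((6 * N : ℕ) : ℤ)]) ≤
        criticalCorr 3 2 ![Pi.single 0 ((0 : ℕ) : ℤ), Pi.single 0 ((2 * N : ℕ) : ℤ)] *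
            criticalCorr 3 2 ![Pi.single 0 ((3 * N : ℕ) : ℤ), Pi.single 0 ((6 * N : ℕ) : ℤ)] *
          (criticalCorr 3 2 ![Pi.single 0 ((0 : ℕ) : ℤ), Pi.single 0 ((6 * N : ℕ) : ℤ)] *
            criticalCorr 3 2 ![Pi.single 0 ((2 * N : ℕ) : ℤ), Pi.single 0 ((3 * N : ℕ) : ℤ)])) :
    ∃ K : ℕ, ∀ k : ℕ, K ≤ k →
      criticalCorr 3 4 ![Pi.single 0 ((0 : ℕ) : ℤ), Pi.single 0 ((2 * 2 ^ (k + 1) : ℕ) : ℤ),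
          Pi.single 0 ((3 * 2 ^ (k + 1) : ℕ) : ℤ), Pi.single 0 ((6 * 2 ^ (k + 1) : ℕ) : ℤ)] *
          (criticalCorr 3 2 ![Pi.single 0 ((0 : ℕ) : ℤ), Pi.single 0 ((3 * 2 ^ (k + 1) : ℕ) : ℤ)] *
            criticalCorr 3 2 ![Pi.single 0 ((2 * 2 ^ (k + 1) : ℕ) : ℤ),
              Pi.single 0 ((6 * 2 ^ (k + 1) : ℕ) : ℤ)]) ≤
        criticalCorr 3 2 ![Pi.single 0 ((0 : ℕ) : ℤ), Pi.single 0 ((2 * 2 ^ (k + 1) : ℕ) : ℤ)] *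
            criticalCorr 3 2 ![Pi.single 0 ((3 * 2 ^ (k + 1) : ℕ) : ℤ),
              Pi.single 0 ((6 * 2 ^ (k + 1) : ℕ) : ℤ)] *
          (criticalCorr 3 2 ![Pi.single 0 ((0 : ℕ) : ℤ), Pi.single 0 ((6 * 2 ^ (k + 1) : ℕ) : ℤ)] *
            criticalCorr 3 2 ![Pi.single 0 ((2 * 2 ^ (k + 1) : ℕ) : ℤ),
              Pi.single 0 ((3 * 2 ^ (k + 1) : ℕ) : ℤ)]) := by
  refine ⟨N₀, fun k hk => h (2 ^ (k + 1)) ?_ Nat.one_le_two_pow⟩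
  calc N₀ ≤ k := hk
    _ ≤ k + 1 := Nat.le_succ k
    _ ≤ 2 ^ (k + 1) := (Nat.lt_two_pow_self).le

/-- The scale-indexed balanced form suffices for the sub-problem: `(∀ N ≥ N₀, SPC(2N,N,3N)) → SubPtolemyFloor →
MoebiusLimit → Ising3DConformalLimit`. [cite: DuminilCopinICM2022, §8.1] -/
theorem transfer_ising3D_of_balanced (N₀ : ℕ)
    (h : ∀ N : ℕ, N₀ ≤ N → 1 ≤ N →
      criticalCorr 3 4 ![Pi.single 0 ((0 : ℕ) : ℤ), Pi.single 0 ((2 * N : ℕ) : ℤ),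
          Pi.single 0 ((3 * N : ℕ) : ℤ), Pi.single 0 ((6 * N : ℕ) : ℤ)] *
          (criticalCorr 3 2 ![Pi.single 0 ((0 : ℕ) : ℤ), Pi.single 0 ((3 * N : ℕ) : ℤ)] *
            criticalCorr 3 2 ![Pi.single 0 ((2 * N : ℕ) : ℤ), Pi.single 0 ((6 * N : ℕ) : ℤ)]) ≤
        criticalCorr 3 2 ![Pi.single 0 ((0 : ℕ) : ℤ), Pi.single 0 ((2 * N : ℕ) : ℤ)] *
            criticalCorr 3 2 ![Pi.single 0 ((3 * N : ℕ) : ℤ), Pi.single 0 ((6 * N : ℕ) : ℤ)] *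
          (criticalCorr 3 2 ![Pi.single 0 ((0 : ℕ) : ℤ), Pi.single 0 ((6 * N : ℕ) : ℤ)] *
            criticalCorr 3 2 ![Pi.single 0 ((2 * N : ℕ) : ℤ), Pi.single 0 ((3 * N : ℕ) : ℤ)]))
    (hF : SubPtolemyFloor) (hML : MoebiusLimit) : _root_.Ising3DConformalLimit :=
  transfer_ising3D_of_eventualBalanced (transfer_eventualBalanced_of_balanced N₀ h) hF hML

/-- Sanity link: the route's own deciding theorem re-derived THROUGH the transfer (so the weakening loses nothing the
route had): `Interlacing → SubPtolemyFloor → MoebiusLimit → Ising3DConformalLimit`. [cite: DuminilCopinICM2022, §8.1] -/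
theorem transfer_closes_of_interlacing (hI : Interlacing) (hF : SubPtolemyFloor) (hML : MoebiusLimit) :
    _root_.Ising3DConformalLimit :=
  transfer_ising3D_of_eventualBalanced (transfer_eventualBalanced_of_interlacing hI) hF hML

end Summit.CriticalPhenomena.Ising3DConformalLimit.Cruxes.Interlacing.Sketch

end
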